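import Summits.ResolutionOfSingularities.ResolutionOfSingularities.Theorems.RadicialJungCleanModelsF75cPrincipalization
import Literature.AlgebraicGeometry.Resolution.PrincipalizationToResolution
import Literature.AlgebraicGeometry.Resolution.PrimeDivisorIdeals
import Literature.AlgebraicGeometry.Resolution.EffectiveCartierStalks
import HarnessLib

/-!
# [F-75c discharge, brick N1] Regular Noetherian schemes: irreducible components as integral clopen pieces, germs under
# open immersions, and «locally principal with nowhere dense support ⇒ effective Cartier»

Cell res-hironaka, D-0154 INPUTS discharger `res-inputs-p-f75c` for the named fact F-75c
`Literature.AlgebraicGeometry.Resolution.Stacks0BIC_embeddedResolutionCurvesInSurfaces_locus`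
(`--supports stmt-ResolutionOfSingularities-15917 --as helper`). F-75c's scheme `X` is Noetherian with REGULAR local
rings but not assumed integral: it is the disjoint union of its irreducible components, which are open and closed
(`Scheme.IsRegular.coe_irreducibleComponentOpen`) and integral as open subschemes. This file provides the pieces for
running the integral-case bricks component by component:

* `isPrincipal_stalkIdeal_comap_iff_of_isOpenImmersion`, `coe_nonPrincipalLocus_comap_of_isOpenImmersion` — germs and
  the non-locally-principal locus under an open immersion;
* `exists_component_opens` — every point lies in an open-and-closed integral piece (its irreducible component);
* `stalkIdeal_ne_bot_of_isNowhereDense`, **`isEffectiveCartier_of_isLocallyPrincipal_of_isNowhereDense`** — on a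
  Noetherian scheme with regular local rings a locally principal ideal sheaf with nowhere dense support is an effective
  Cartier divisor (its germs are non-zero in the integral local rings: a vanishing germ would vanish at the generic
  point of the component, whose closure — an open set — would lie in the support).

HONEST FRAMING: bookkeeping over tree theorems; nothing here is a statement of [Hironaka2017]. AI-written; AI review is
weaker than expert review. References: The Stacks Project, Tags 0BIC, 01WS, 0357 [StacksProject].
-/

noncomputable section

set_option linter.dupNamespace false -- mandated namespace of this single-conjunct summit

open CategoryTheory AlgebraicGeometry TopologicalSpace IsLocalRing

namespace Summit.ResolutionOfSingularities.ResolutionOfSingularities.Theorems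

namespace F75c

open Literature.AlgebraicGeometry.Resolution
open Scheme.IdealSheafData

universe u

/-! ## Germs under open immersions -/

section OpenImmersion

variable {U X : Scheme.{u}} (j : U ⟶ X) [IsOpenImmersion j]

/-- Principality is invariant under ring isomorphisms. [folklore] -/
theorem isPrincipal_map_ringEquiv_iff {A B : Type*} [CommRing A] [CommRing B] (e : A ≃+* B) (𝔞 : Ideal A) :
    (𝔞.map e.toRingHom).IsPrincipal ↔ 𝔞.IsPrincipal := by
  constructor
  · intro h
    have h2 := h.map_ringHom e.symm.toRingHom
    rw [Ideal.map_map] at h2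
    have hid : e.symm.toRingHom.comp e.toRingHom = RingHom.id A := RingHom.ext fun a => e.symm_apply_apply a
    rwa [hid, Ideal.map_id] at h2
  · intro h
    exact h.map_ringHom e.toRingHom

/-- **The germ of `I|_U` at `u` is principal iff the germ of `I` at `j u` is** (the stalk map of an open immersion is an
isomorphism). [cite: StacksProject, Tag 01WS] -/
theorem isPrincipal_stalkIdeal_comap_iff_of_isOpenImmersion (I : X.IdealSheafData) (u : U) :
    (stalkIdeal (I.comap j) u).IsPrincipal ↔ (stalkIdeal I (j u)).IsPrincipal := by
  rw [stalkIdeal_comap_eq_map_stalkMap]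
  exact isPrincipal_map_ringEquiv_iff (asIso (j.stalkMap u)).commRingCatIsoToRingEquiv _

/-- **The non-locally-principal locus of `I|_U` is the trace of that of `I`.** [cite: StacksProject, Tag 01WS] -/
theorem coe_nonPrincipalLocus_comap_of_isOpenImmersion [IsLocallyNoetherian X] (I : X.IdealSheafData) :
    (nonPrincipalLocus (I.comap j) : Set U) = j ⁻¹' (nonPrincipalLocus I : Set X) := by
  haveI : IsLocallyNoetherian U := isLocallyNoetherian_of_isOpenImmersion j
  ext u
  rw [coe_nonPrincipalLocus_eq_setOf_not_isPrincipal, Set.mem_preimage, coe_nonPrincipalLocus_eq_setOf_not_isPrincipal,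
    Set.mem_setOf_eq, Set.mem_setOf_eq, isPrincipal_stalkIdeal_comap_iff_of_isOpenImmersion]

end OpenImmersion

/-! ## Irreducible components of a regular Noetherian scheme -/

section Components

variable {X : Scheme.{u}} [IsNoetherian X]

/-- **Every point of a Noetherian scheme with regular local rings lies in an open-and-closed integral piece**: its
irreducible component, open (`Scheme.IsRegular.coe_irreducibleComponentOpen`), closed, irreducible and reduced.
[cite: StacksProject, Tag 0357] -/
theorem exists_component_opens (hreg : Scheme.IsRegular X) (x : X) :
    ∃ U : X.Opens, x ∈ U ∧ IsClosed (U : Set X) ∧ (U : Set X) ∈ irreducibleComponents X ∧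
      IsIntegral (U : Scheme.{u}) := by
  have hC := irreducibleComponent_mem_irreducibleComponents x
  refine ⟨X.irreducibleComponentOpen (irreducibleComponent x), ?_, ?_, ?_, ?_⟩
  · change x ∈ (X.irreducibleComponentOpen (irreducibleComponent x) : Set X)
    rw [hreg.coe_irreducibleComponentOpen hC]; exact mem_irreducibleComponent
  · rw [hreg.coe_irreducibleComponentOpen hC]; exact isClosed_irreducibleComponent
  · rw [hreg.coe_irreducibleComponentOpen hC]; exact hC
  · haveI : IsReduced X := hreg.isReduced
    haveI : IsReduced (X.irreducibleComponentOpen (irreducibleComponent x) : Scheme.{u}) :=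
      isReduced_of_isOpenImmersion (X.irreducibleComponentOpen (irreducibleComponent x)).ι
    haveI : IrreducibleSpace (X.irreducibleComponentOpen (irreducibleComponent x) : Scheme.{u}) := by
      have h : IsIrreducible ((X.irreducibleComponentOpen (irreducibleComponent x) : X.Opens) : Set X) := by
        rw [hreg.coe_irreducibleComponentOpen hC]; exact isIrreducible_irreducibleComponent
      exact Subtype.irreducibleSpace h
    exact isIntegral_of_irreducibleSpace_of_isReduced _

end Components

/-! ## Locally principal with nowhere dense support ⇒ effective Cartier -/

section Cartier

variable {X : Scheme.{u}} [IsNoetherian X]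

/-- **On a Noetherian scheme with regular local rings, an ideal sheaf with nowhere dense support has non-zero germs**:
a vanishing germ at `x` vanishes at the generic point `ξ` of the component through `x` (`I_ξ = I_x·𝒪_ξ`), so `ξ` and
hence its closure — the component, an OPEN set — would lie in the support. [cite: StacksProject, Tag 0357] -/
theorem stalkIdeal_ne_bot_of_isNowhereDense (hreg : Scheme.IsRegular X) {I : X.IdealSheafData}
    (hI : IsNowhereDense (I.support : Set X)) (x : X) : stalkIdeal I x ≠ ⊥ := by
  intro hx
  obtain ⟨U, hxU, hUcl, hUC, -⟩ := exists_component_opens hreg x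
  have hirr : IsIrreducible (U : Set X) := hUC.1
  -- the generic point `ξ` of the component specialises to `x`, and `I_ξ = I_x·𝒪_ξ = 0`
  set ξ := hirr.genericPoint with hξ
  have hgen : IsGenericPoint ξ (U : Set X) := by
    have h := hirr.isGenericPoint_genericPoint_closure
    rwa [hUcl.closure_eq] at h
  have hsp : ξ ⤳ x := hgen.specializes hxU
  have hξbot : stalkIdeal I ξ = ⊥ := by
    rw [← stalkIdeal_map_stalkSpecializes I hsp, hx, Ideal.map_bot]
  have hξsupp : ξ ∈ (I.support : Set X) :=
    (mem_support_iff_stalkIdeal_le I ξ).mpr (by rw [hξbot]; exact bot_le)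
  -- so the whole (open) component lies in the support: contradiction with nowhere density
  have hsub : (U : Set X) ⊆ (I.support : Set X) := by
    rw [← hgen.def]
    exact closure_minimal (Set.singleton_subset_iff.mpr hξsupp) I.support.isClosed
  have hint : x ∈ interior (closure (I.support : Set X)) := by
    rw [I.support.isClosed.closure_eq]
    exact interior_mono hsub (by rw [U.isOpen.interior_eq]; exact hxU)
  have h0 : interior (closure (I.support : Set X)) = ∅ := hI
  rw [h0] at hint
  exact hint

/-- **On a Noetherian scheme with regular local rings, a locally principal ideal sheaf with nowhere dense support is an
effective Cartier divisor** (its local generators have non-zero germs in the integral local rings).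
[cite: StacksProject, Tag 01WS] [cite: StacksProject, Tag 0BIB (Lemma 54.15.5)] -/
theorem isEffectiveCartier_of_isLocallyPrincipal_of_isNowhereDense (hreg : Scheme.IsRegular X)
    {I : X.IdealSheafData} (hlp : IsLocallyPrincipal I) (hI : IsNowhereDense (I.support : Set X)) :
    IsEffectiveCartier I := by
  refine isEffectiveCartier_of_forall_mem_nonZeroDivisors fun x _ => ?_
  haveI := hreg x
  haveI := isDomain_of_isRegularLocalRing (X.presheaf.stalk x)
  obtain ⟨g, hg⟩ := (hlp x).isPrincipal_stalkIdeal
  have hg' : stalkIdeal I x = Ideal.span {g} := by rw [hg]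
  refine ⟨g, mem_nonZeroDivisors_of_ne_zero ?_, hg'⟩
  rintro rfl
  exact stalkIdeal_ne_bot_of_isNowhereDense hreg hI x (by rw [hg', Ideal.span_singleton_eq_bot])

end Cartier

end F75c

end Summit.ResolutionOfSingularities.ResolutionOfSingularities.Theorems

end
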